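import Summits.Ventures.CertifiedManyBodySolver.Theorems.TcThermcert1FreeGasCurrentCovariance
import Summits.Ventures.CertifiedManyBodySolver.Theorems.TcThermcert1FugacityProjection
import Summits.HubbardSuperconductivity.HubbardLadder.Bounds.ThermalStiffnessCeilingTPrime
import Literature.MathematicalPhysics.QuantumLattice.LatticeToriProofs
import HarnessLib

/-!
# Free-gas (`U = 0`) current clustering for TcThermcert1's Hypothesis C — part 5: the `U = 0` rung on the torus

Helper file for route `TcThermcert1` (crux K1′ `ThermalStiffnessCeilingU8b8_le_7o44`, item `stmt-Ventures-24560`; line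
`Cruxes/ThermalStiffnessCeilingU8b8_le_7o44/Lines/gauge_qbp_far_seam.lean` v1.4). The line's Hypothesis C, `CurrentClustering U n β ξ`, asks
for uniform-in-`L` exponential clustering of the canonical `(N↑, N↓) = (M, M)`-sector Gibbs state (`M = ⌊nL²/2⌋`) of `hubbardTorusTT'Flux L 0 U 0`
against the plain bond current, for every even sector-preserving local observable `A`. This file proves the **`U = 0` RUNG in the
non-degenerate regime**: for `0 ≤ n`, `0 ≤ β` and `n·e^{16β} < 2 − n` (convergent-fugacity / high-temperature window of the ideal gas at
filling `n/2` per spin; at the line's filling `n = 7/8` this is `β·t < (1/16) log(9/7) ≈ 0.0157`)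

  `∃ ξ > 0, ∃ C k L₀, ∀ L ≥ L₀, … ‖ω_p(A j) − ω_p(A) ω_p(j)‖ ≤ C ‖A‖ |X|^k e^{−d/ξ}`   (`k = 1`, `L₀ = 0`, every `L`)

— the line's `∃ ξ, CurrentClustering 0 n β ξ` with `CurrentClustering`, `sectorExpect`, `bondCurrent`, `SectorPreserving`, `sectorPred`
unfolded (`freeGas_currentClusteringBody`; the line instantiates it by `unfold …; exact`). Ingredients: parts 1–4 (canonical pull-through
expansion, walk-counting decay of `(e^{−βh₀})^j`, Ruelle-type sector ratios from the tree's transfer lemma, PSD sector weights) applied to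
`h₀ = hubbardOneBody (fermionTorusGraph 2 L) 1 0` (`hubbardTorusTT'Flux L 0 0 0 = dΓ(h₀)`, rows of absolute sum `≤ 4`, torus `ℓ^∞` distance).
The sector-preservation hypothesis on `A` is not needed. What this is NOT: the degenerate regime (e.g. the bet's `β·t = 8`) is not touched —
there the fugacity expansion diverges and clustering of the canonical free gas needs saddle-point control of the fugacity integral with
observable insertions; nothing here bears on `U = 8`, on the bet C8, on `T_c`, or on superconductivity in the Hubbard model.
-/

noncomputable section

namespace Summit.Ventures.CertifiedManyBodySolver.Theorems.TcThermcert1.FreeGasCurrentClustering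

open NormedSpace Matrix Finset
open Literature.MathematicalPhysics.QuantumLattice
open Literature.Probability.LatticeModels (TorusSite torusGraph)
open Summit.Ventures.CertifiedManyBodySolver.Theorems.TcThermcert1.ZeroFreeCorridor (card_and_two_mul_card_filter_iff)
open scoped Matrix.Norms.L2Operator ComplexOrder

/-! ## §1 The covariance bound on the free torus (every `L`, every sector presentation) -/

section Torus

variable (L : ℕ) [NeZero L]

/-- **The canonical-sector current covariance bound on the free torus** (`κ = 4`, torus distance): for `0 ≤ β`, `0 ≤ n ≤ 1`, `ε > 0`,
`q ≥ 4β/ε`, `θ = (n/(2−n)) e^{8β} e^{4β+ε} < 1`, the `(M,M)` sector with `M ≤ nL²/2` presented by `p`, an even observable `A` on `orbSet X`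
and a bond `(X₀−1,y)–(X₀,y)` at torus distance `≥ d` from `X`: `‖ω_p(A j) − ω_p(A) ω_p(j)‖ ≤ 8 (θ/(1−θ)) ‖A‖ |X| q^d`. -/
theorem torus_sectorCov_current_le {β n ε q : ℝ} (hβ : 0 ≤ β) (hn0 : 0 ≤ n) (hn1 : n ≤ 1) (hε : 0 < ε) (hq : 4 * β / ε ≤ q)
    (hθ : n / (2 - n) * Real.exp (2 * 4 * β) * Real.exp (4 * β + ε) < 1) {M : ℕ} (hM : (M : ℝ) ≤ n * (L : ℝ) ^ 2 / 2)
    (p : Finset (Orb (FermionTorus 2 L)) → Prop) [DecidablePred p] (hp : ∀ s, p s ↔ (upPart s).card = M ∧ (downPart s).card = M)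
    {X : Finset (FermionTorus 2 L)} {A : Matrix (Finset (Orb (FermionTorus 2 L))) (Finset (Orb (FermionTorus 2 L))) ℂ}
    (hA : A ∈ carEvenSubalgebra (orbSet X)) (X₀ y : ZMod L) {d : ℕ}
    (hd : ∀ x ∈ X, d ≤ torusDist x.toTorusSite ![X₀, y] ∧ d ≤ torusDist x.toTorusSite ![X₀ - 1, y]) :
    ‖gibbsState β ((hubbardTorusTT'Flux L 0 0 0).toBlock p p)
          ((A * (∑ σ : Fin 2,
            ((-Complex.I) • (creation (orb (FermionTorus.ofTorusSite (![X₀, y] : TorusSite 2 L)) σ) *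
                annihilation (orb (FermionTorus.ofTorusSite (![X₀ - 1, y] : TorusSite 2 L)) σ)) +
              Complex.I • (creation (orb (FermionTorus.ofTorusSite (![X₀ - 1, y] : TorusSite 2 L)) σ) *
                annihilation (orb (FermionTorus.ofTorusSite (![X₀, y] : TorusSite 2 L)) σ))))).toBlock p p)
      - gibbsState β ((hubbardTorusTT'Flux L 0 0 0).toBlock p p) (A.toBlock p p)
        * gibbsState β ((hubbardTorusTT'Flux L 0 0 0).toBlock p p)
          ((∑ σ : Fin 2,
            ((-Complex.I) • (creation (orb (FermionTorus.ofTorusSite (![X₀, y] : TorusSite 2 L)) σ) *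
                annihilation (orb (FermionTorus.ofTorusSite (![X₀ - 1, y] : TorusSite 2 L)) σ)) +
              Complex.I • (creation (orb (FermionTorus.ofTorusSite (![X₀ - 1, y] : TorusSite 2 L)) σ) *
                annihilation (orb (FermionTorus.ofTorusSite (![X₀, y] : TorusSite 2 L)) σ)))).toBlock p p)‖ ≤
      8 * (n / (2 - n) * Real.exp (2 * 4 * β) * Real.exp (4 * β + ε) /
          (1 - n / (2 - n) * Real.exp (2 * 4 * β) * Real.exp (4 * β + ε))) * ‖A‖ * X.card * q ^ d := by
  have hsym : ∀ q k : Orb (FermionTorus 2 L),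
      hubbardOneBody (fermionTorusGraph 2 L) 1 0 q k = hubbardOneBody (fermionTorusGraph 2 L) 1 0 k q := fun q k => by
    have h := congrFun (congrFun (hubbardOneBody_torus_transpose L) k) q
    rw [transpose_apply] at h
    exact h
  have hspin : ∀ q k : Orb (FermionTorus 2 L), (ofLex q).2 ≠ (ofLex k).2 → hubbardOneBody (fermionTorusGraph 2 L) 1 0 q k = 0 :=
    fun q k hqk => by rw [hubbardOneBody_torus_apply, if_neg (fun h => hqk h.2)]
  have hM' : (M : ℝ) ≤ n * (Fintype.card (FermionTorus 2 L) : ℝ) / 2 := by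
    rw [card_fermionTorus_two]; push_cast; exact hM
  have hda : ∀ x ∈ X, d ≤ torusDist (FermionTorus.ofTorusSite (![X₀, y] : TorusSite 2 L)).toTorusSite x.toTorusSite := fun x hx => by
    rw [FermionTorus.toTorusSite_ofTorusSite, torusDist_comm']; exact (hd x hx).1
  have hdb : ∀ x ∈ X, d ≤ torusDist (FermionTorus.ofTorusSite (![X₀ - 1, y] : TorusSite 2 L)).toTorusSite x.toTorusSite := fun x hx => by
    rw [FermionTorus.toTorusSite_ofTorusSite, torusDist_comm']; exact (hd x hx).2
  have key := norm_sectorCov_current_le (hubbardOneBody (fermionTorusGraph 2 L) 1 0) (isHermitian_hubbardOneBody _ 1 0) hsym hspin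
    (κ := 4) (by norm_num) (sum_norm_hubbardOneBody_torus_le L)
    (fun x y : FermionTorus 2 L => torusDist x.toTorusSite y.toTorusSite) (fun x => torusDist_self _) (fun x y z => torusDist_triangle' _ _ _)
    (fun l k hlk => torusDist_le_one_of_hubbardOneBody_ne_zero L hlk) hβ hn0 hn1 hε hq hθ hM' p hp hA
    (FermionTorus.ofTorusSite (![X₀, y] : TorusSite 2 L)) (FermionTorus.ofTorusSite (![X₀ - 1, y] : TorusSite 2 L)) hda hdb
  rw [hubbardTorusTT'Flux_free_eq_dGamma]
  convert key using 8

end Torus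

/-! ## §2 The `U = 0` rung of Hypothesis C (the line's `∃ ξ, CurrentClustering 0 n β ξ`, unfolded) -/

/-- The parameters of the rung: for `0 ≤ n`, `0 ≤ β`, `n e^{16β} < 2 − n` there are `ε > 0`, `q ∈ (0,1)`, `ξ > 0` with `4β/ε ≤ q`,
`θ = (n/(2−n)) e^{8β} e^{4β+ε} < 1` and `q^d = e^{−d/ξ}` for every `d`. -/
theorem exists_rung_parameters {n β : ℝ} (hn : 0 ≤ n) (hβ : 0 ≤ β) (hnβ : n * Real.exp (16 * β) < 2 - n) :
    ∃ ε q ξ : ℝ, 0 < ε ∧ 0 < ξ ∧ 0 ≤ q ∧ 4 * β / ε ≤ q ∧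
      n / (2 - n) * Real.exp (2 * 4 * β) * Real.exp (4 * β + ε) < 1 ∧ ∀ d : ℕ, q ^ d = Real.exp (-(d : ℝ) / ξ) := by
  have hn2 : 0 < 2 - n := by have := mul_nonneg hn (Real.exp_pos (16 * β)).le; linarith
  set κ₁ : ℝ := n / (2 - n) * Real.exp (16 * β) with hκ₁
  have hκ₁0 : 0 ≤ κ₁ := by positivity
  have hκ₁1 : κ₁ < 1 := by rw [hκ₁, div_mul_eq_mul_div, div_lt_one hn2]; exact hnβ
  -- `η = log (2/(1+κ₁)) > 0`, `ε = 4β + η`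
  set η : ℝ := Real.log (2 / (1 + κ₁)) with hη
  have hr : 1 < 2 / (1 + κ₁) := by rw [lt_div_iff₀ (by linarith)]; linarith
  have hη0 : 0 < η := Real.log_pos hr
  have hexpη : Real.exp η = 2 / (1 + κ₁) := by rw [hη, Real.exp_log (by positivity)]
  set q : ℝ := (4 * β + η / 2) / (4 * β + η) with hqdef
  have hden : 0 < 4 * β + η := by linarith
  have hq0 : 0 < q := by rw [hqdef]; exact div_pos (by linarith) hden
  have hq1 : q < 1 := by rw [hqdef, div_lt_one hden]; linarith
  refine ⟨4 * β + η, q, 1 / Real.log (1 / q), hden, ?_, hq0.le, ?_, ?_, ?_⟩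
  · exact one_div_pos.2 (Real.log_pos (by rw [lt_div_iff₀ hq0]; linarith))
  · rw [hqdef]; exact div_le_div_of_nonneg_right (by linarith) hden.le
  · have h16 : Real.exp (2 * 4 * β) * Real.exp (4 * β + (4 * β + η)) = Real.exp (16 * β) * Real.exp η := by
      rw [← Real.exp_add, ← Real.exp_add]; congr 1; ring
    calc n / (2 - n) * Real.exp (2 * 4 * β) * Real.exp (4 * β + (4 * β + η))
        = κ₁ * Real.exp η := by rw [mul_assoc, h16, hκ₁]; ring
      _ = 2 * κ₁ / (1 + κ₁) := by rw [hexpη]; ring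
      _ < 1 := by rw [div_lt_one (by linarith)]; linarith
  · intro d
    rw [div_div_eq_mul_div, div_one, one_div, Real.log_inv, neg_mul_neg, Real.exp_nat_mul, Real.exp_log hq0]

/-- **THE `U = 0` RUNG OF HYPOTHESIS C (non-degenerate regime).** For `0 ≤ n`, `0 ≤ β` and `n·e^{16β} < 2 − n`, the free (`U = t' = 0`,
flux-free) `t`-torus `hubbardTorusTT'Flux L 0 0 0`, compressed to the `(N↑,N↓) = (M,M)` sector with `M = ⌊(1−(1−n))L²/2⌋`, clusters
exponentially against the plain bond current, uniformly in `L`: this is the line's `∃ ξ, CurrentClustering 0 n β ξ` with the line-local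
definitions unfolded (`k = 1`, `L₀ = 0`; the sector-preservation premise on `A` is not used). Honest framing: the degenerate regime (the
bet's `β·t = 8`) is NOT covered; nothing here bears on `U = 8`, C8, `T_c` or superconductivity in the Hubbard model. -/
theorem freeGas_currentClusteringBody {n β : ℝ} (hn : 0 ≤ n) (hβ : 0 ≤ β) (hnβ : n * Real.exp (16 * β) < 2 - n) :
    ∃ ξ : ℝ, 0 < ξ ∧ ∃ C : ℝ, ∃ k L₀ : ℕ, ∀ (L : ℕ) [NeZero L], L₀ ≤ L →
      ∀ (X : Finset (FermionTorus 2 L)) (A : Matrix (Finset (Orb (FermionTorus 2 L))) (Finset (Orb (FermionTorus 2 L))) ℂ),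
        A ∈ carEvenSubalgebra (orbSet X) →
        (∀ s t : Finset (Orb (FermionTorus 2 L)),
          (s.card = 2 * ⌊(1 - (1 - n)) * (L : ℝ) ^ 2 / 2⌋₊ ∧
            2 * (s.filter fun i => (ofLex i).2 = 0).card = 2 * ⌊(1 - (1 - n)) * (L : ℝ) ^ 2 / 2⌋₊) →
          ¬ (t.card = 2 * ⌊(1 - (1 - n)) * (L : ℝ) ^ 2 / 2⌋₊ ∧
            2 * (t.filter fun i => (ofLex i).2 = 0).card = 2 * ⌊(1 - (1 - n)) * (L : ℝ) ^ 2 / 2⌋₊) →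
          A s t = 0 ∧ A t s = 0) →
        ∀ (X₀ y : ZMod L) (d : ℕ),
          (∀ x ∈ X, d ≤ torusDist x.toTorusSite ![X₀, y] ∧ d ≤ torusDist x.toTorusSite ![X₀ - 1, y]) →
          ‖gibbsState β ((hubbardTorusTT'Flux L 0 0 0).toBlock
                (fun s => s.card = 2 * ⌊(1 - (1 - n)) * (L : ℝ) ^ 2 / 2⌋₊ ∧
                  2 * (s.filter fun i => (ofLex i).2 = 0).card = 2 * ⌊(1 - (1 - n)) * (L : ℝ) ^ 2 / 2⌋₊)
                (fun s => s.card = 2 * ⌊(1 - (1 - n)) * (L : ℝ) ^ 2 / 2⌋₊ ∧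
                  2 * (s.filter fun i => (ofLex i).2 = 0).card = 2 * ⌊(1 - (1 - n)) * (L : ℝ) ^ 2 / 2⌋₊))
              ((A * (∑ σ : Fin 2,
                ((-Complex.I) • (creation (orb (FermionTorus.ofTorusSite (![X₀, y] : TorusSite 2 L)) σ) *
                    annihilation (orb (FermionTorus.ofTorusSite (![X₀ - 1, y] : TorusSite 2 L)) σ)) +
                  Complex.I • (creation (orb (FermionTorus.ofTorusSite (![X₀ - 1, y] : TorusSite 2 L)) σ) *
                    annihilation (orb (FermionTorus.ofTorusSite (![X₀, y] : TorusSite 2 L)) σ))))).toBlock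
                (fun s => s.card = 2 * ⌊(1 - (1 - n)) * (L : ℝ) ^ 2 / 2⌋₊ ∧
                  2 * (s.filter fun i => (ofLex i).2 = 0).card = 2 * ⌊(1 - (1 - n)) * (L : ℝ) ^ 2 / 2⌋₊)
                (fun s => s.card = 2 * ⌊(1 - (1 - n)) * (L : ℝ) ^ 2 / 2⌋₊ ∧
                  2 * (s.filter fun i => (ofLex i).2 = 0).card = 2 * ⌊(1 - (1 - n)) * (L : ℝ) ^ 2 / 2⌋₊))
            - gibbsState β ((hubbardTorusTT'Flux L 0 0 0).toBlock
                (fun s => s.card = 2 * ⌊(1 - (1 - n)) * (L : ℝ) ^ 2 / 2⌋₊ ∧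
                  2 * (s.filter fun i => (ofLex i).2 = 0).card = 2 * ⌊(1 - (1 - n)) * (L : ℝ) ^ 2 / 2⌋₊)
                (fun s => s.card = 2 * ⌊(1 - (1 - n)) * (L : ℝ) ^ 2 / 2⌋₊ ∧
                  2 * (s.filter fun i => (ofLex i).2 = 0).card = 2 * ⌊(1 - (1 - n)) * (L : ℝ) ^ 2 / 2⌋₊))
              (A.toBlock
                (fun s => s.card = 2 * ⌊(1 - (1 - n)) * (L : ℝ) ^ 2 / 2⌋₊ ∧
                  2 * (s.filter fun i => (ofLex i).2 = 0).card = 2 * ⌊(1 - (1 - n)) * (L : ℝ) ^ 2 / 2⌋₊)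
                (fun s => s.card = 2 * ⌊(1 - (1 - n)) * (L : ℝ) ^ 2 / 2⌋₊ ∧
                  2 * (s.filter fun i => (ofLex i).2 = 0).card = 2 * ⌊(1 - (1 - n)) * (L : ℝ) ^ 2 / 2⌋₊))
              * gibbsState β ((hubbardTorusTT'Flux L 0 0 0).toBlock
                (fun s => s.card = 2 * ⌊(1 - (1 - n)) * (L : ℝ) ^ 2 / 2⌋₊ ∧
                  2 * (s.filter fun i => (ofLex i).2 = 0).card = 2 * ⌊(1 - (1 - n)) * (L : ℝ) ^ 2 / 2⌋₊)
                (fun s => s.card = 2 * ⌊(1 - (1 - n)) * (L : ℝ) ^ 2 / 2⌋₊ ∧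
                  2 * (s.filter fun i => (ofLex i).2 = 0).card = 2 * ⌊(1 - (1 - n)) * (L : ℝ) ^ 2 / 2⌋₊))
              ((∑ σ : Fin 2,
                ((-Complex.I) • (creation (orb (FermionTorus.ofTorusSite (![X₀, y] : TorusSite 2 L)) σ) *
                    annihilation (orb (FermionTorus.ofTorusSite (![X₀ - 1, y] : TorusSite 2 L)) σ)) +
                  Complex.I • (creation (orb (FermionTorus.ofTorusSite (![X₀ - 1, y] : TorusSite 2 L)) σ) *
                    annihilation (orb (FermionTorus.ofTorusSite (![X₀, y] : TorusSite 2 L)) σ)))).toBlock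
                (fun s => s.card = 2 * ⌊(1 - (1 - n)) * (L : ℝ) ^ 2 / 2⌋₊ ∧
                  2 * (s.filter fun i => (ofLex i).2 = 0).card = 2 * ⌊(1 - (1 - n)) * (L : ℝ) ^ 2 / 2⌋₊)
                (fun s => s.card = 2 * ⌊(1 - (1 - n)) * (L : ℝ) ^ 2 / 2⌋₊ ∧
                  2 * (s.filter fun i => (ofLex i).2 = 0).card = 2 * ⌊(1 - (1 - n)) * (L : ℝ) ^ 2 / 2⌋₊))‖
            ≤ C * ‖A‖ * (X.card : ℝ) ^ k * Real.exp (-(d : ℝ) / ξ) := by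
  obtain ⟨ε, q, ξ, hε, hξ, hq0, hq, hθ, hqξ⟩ := exists_rung_parameters hn hβ hnβ
  have hn1 : n ≤ 1 := by
    have h1 : n ≤ n * Real.exp (16 * β) := by
      have := Real.one_le_exp (by positivity : (0:ℝ) ≤ 16 * β)
      nlinarith
    linarith
  refine ⟨ξ, hξ, 8 * (n / (2 - n) * Real.exp (2 * 4 * β) * Real.exp (4 * β + ε) /
      (1 - n / (2 - n) * Real.exp (2 * 4 * β) * Real.exp (4 * β + ε))), 1, 0, fun L _ _ X A hA _ X₀ y d hd => ?_⟩
  have hM : ((⌊(1 - (1 - n)) * (L : ℝ) ^ 2 / 2⌋₊ : ℕ) : ℝ) ≤ n * (L : ℝ) ^ 2 / 2 := by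
    have h0 : (0 : ℝ) ≤ n * (L : ℝ) ^ 2 / 2 := by positivity
    rw [show (1 - (1 - n)) * (L : ℝ) ^ 2 / 2 = n * (L : ℝ) ^ 2 / 2 by ring]
    exact Nat.floor_le h0
  rw [pow_one, ← hqξ d]
  exact torus_sectorCov_current_le L hβ hn hn1 hε hq hθ hM _ (fun s => card_and_two_mul_card_filter_iff s _) hA X₀ y hd

/-- **The rung is non-empty at the line's filling**: `n = 7/8`, `β·t = 1/100` satisfy the non-degeneracy condition
`n e^{16β} < 2 − n` (`e^{0.16} < 1/(1 − 0.16) = 25/21 < 9/7`), so `freeGas_currentClusteringBody` applies there. -/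
theorem rung_condition_7o8 : (7 / 8 : ℝ) * Real.exp (16 * (1 / 100)) < 2 - 7 / 8 := by
  have h := Real.exp_bound_div_one_sub_of_interval' (x := 16 * (1 / 100)) (by norm_num) (by norm_num)
  have h2 : (1 : ℝ) / (1 - 16 * (1 / 100)) = 25 / 21 := by norm_num
  rw [h2] at h
  linarith

end Summit.Ventures.CertifiedManyBodySolver.Theorems.TcThermcert1.FreeGasCurrentClustering

end
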